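import Mathlib
import HarnessLib

/-!
# Route `KLProgramme` — ENGINE (stmt-HubbardSuperconductivity-20437 `KLRegimeEngineV17F2`), row (c), binder #9, cure (C′) of located #22
# «(c)-OUT-NEAR-SLICE-LEGS»: second brick — ODD MOMENTUM SUMS ARE TWO-SIDED SHELL-ASYMMETRY INTEGRALS (layer form)
# (cell gate-hubbard-kl, seat hubbard-kl-k3c2-p2 g30, technique «thermal-bar induction n ≤ nScales β + 1 with EngineBoundsAtV4S sums»; pen (R595)/(R596) choice (i))

WHY.  After the Matsubara-oddness brick (`…SplitBornOddness`: an even frequency weight against the frame rung gives `e_K(k)·h(e_K(k)²)`), the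
localised born sum of the self-energy line is a momentum sum `Σ_k F(e_K(k))` with `F` ODD and supported on the slice shell `|e| ≤ Λ`.  Such a sum
does not see the density of states `N(0)` but only its two-sided ASYMMETRY (located #21's constant `c_T = (75/512)·N′`).  This file is the
model-free layer-cake identity and bound behind that statement, for an arbitrary finite family of levels `e : ι → ℝ`:

* `klol_integral_mul_ite_lt` / `…_of_nonpos` — `∫₀^Λ f(t)·[t < e] dt = ∫₀^e f` for `0 ≤ e ≤ Λ`, `= 0` for `e ≤ 0`;
* `klol_odd_eq_integral` — for `F` odd with `F(x) = ∫₀^x f` on `[0, Λ]` and `|e| ≤ Λ`: `F(e) = ∫₀^Λ f(t)·([t < e] − [e < −t]) dt`;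
* **`klol_sum_odd_eq_integral_asym`** — `Σ_{k∈S} F(e_k) = ∫₀^Λ f(t)·A_S(t) dt` with the TWO-SIDED SHELL ASYMMETRY
  `A_S(t) = #{k ∈ S : t < e_k} − #{k ∈ S : e_k < −t}` (all `|e_k| ≤ Λ`);
* **`klol_abs_sum_odd_le`** — hence `|Σ_{k∈S} F(e_k)| ≤ Λ·C_f·A` whenever `|f| ≤ C_f` on `[0, Λ]` and `|A_S(t)| ≤ A` on `[0, Λ]`.
The GEOMETRIC input (the asymmetry of the frame band's shells on the torus, `A ≲ N′·Λ²L² + lattice rounding`) is the next brick; nothing here is about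
the model.  Pure real analysis; nothing asserts (c), K3 or superconductivity.
References: Lieb–Loss, Analysis, Thm. 1.13 (layer cake) [folklore]; BGM 2006 §2.9 [cite: BenfattoGiulianiMastropietro2006].
-/

noncomputable section

namespace Summit.HubbardSuperconductivity.HubbardSuperconductivity.Theorems.KLRegimeSplit

set_option linter.dupNamespace false -- summit = problem name (single-conjunct summit), D-0017

open Real Set Finset MeasureTheory intervalIntegral

/-! ## §1 Interval integrals against the indicator `[t < e]` -/

/-- `f(t)·[t < e] = (Iio e).indicator f (t)`. -/
theorem klol_mul_ite_lt_eq_indicator (f : ℝ → ℝ) (e : ℝ) :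
    (fun t => f t * (if t < e then (1 : ℝ) else 0)) = (Set.Iio e).indicator f := by
  funext t
  simp only [Set.indicator_apply, Set.mem_Iio, mul_ite, mul_one, mul_zero]

/-- Interval integrability of `f(t)·[t < e]` on `[0, Λ]` from that of `f`. -/
theorem klol_intervalIntegrable_mul_ite_lt {f : ℝ → ℝ} {Λ : ℝ} (hf : IntervalIntegrable f volume 0 Λ) (e : ℝ) :
    IntervalIntegrable (fun t => f t * (if t < e then (1 : ℝ) else 0)) volume 0 Λ := by
  rw [klol_mul_ite_lt_eq_indicator]
  exact ⟨hf.1.indicator measurableSet_Iio, hf.2.indicator measurableSet_Iio⟩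

/-- `∫₀^Λ f(t)·[t < e] dt = ∫₀^e f` for `0 ≤ e ≤ Λ`. -/
theorem klol_integral_mul_ite_lt (f : ℝ → ℝ) {Λ e : ℝ} (he0 : 0 ≤ e) (heΛ : e ≤ Λ) :
    ∫ t in (0 : ℝ)..Λ, f t * (if t < e then (1 : ℝ) else 0) = ∫ t in (0 : ℝ)..e, f t := by
  have hΛ : 0 ≤ Λ := he0.trans heΛ
  rw [klol_mul_ite_lt_eq_indicator, integral_of_le hΛ, integral_of_le he0, setIntegral_indicator measurableSet_Iio]
  have hset : Set.Ioc (0 : ℝ) Λ ∩ Set.Iio e = Set.Ioo 0 e := by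
    ext t
    simp only [Set.mem_inter_iff, Set.mem_Ioc, Set.mem_Iio, Set.mem_Ioo]
    constructor
    · rintro ⟨⟨h0, _⟩, he⟩; exact ⟨h0, he⟩
    · rintro ⟨h0, he⟩; exact ⟨⟨h0, he.le.trans heΛ⟩, he⟩
  rw [hset, integral_Ioc_eq_integral_Ioo]

/-- `∫₀^Λ f(t)·[t < e] dt = 0` for `e ≤ 0 ≤ Λ`. -/
theorem klol_integral_mul_ite_lt_of_nonpos (f : ℝ → ℝ) {Λ e : ℝ} (hΛ : 0 ≤ Λ) (he : e ≤ 0) :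
    ∫ t in (0 : ℝ)..Λ, f t * (if t < e then (1 : ℝ) else 0) = 0 := by
  rw [klol_mul_ite_lt_eq_indicator, integral_of_le hΛ, setIntegral_indicator measurableSet_Iio]
  have hset : Set.Ioc (0 : ℝ) Λ ∩ Set.Iio e = ∅ := by
    ext t
    simp only [Set.mem_inter_iff, Set.mem_Ioc, Set.mem_Iio, Set.mem_empty_iff_false, iff_false, not_and, not_lt, and_imp]
    intro h0 _
    exact he.trans h0.le
  rw [hset, Measure.restrict_empty, integral_zero_measure]

/-! ## §2 An odd function of one level is a signed indicator integral -/

/-- **One level**: `F` odd, `F(x) = ∫₀^x f` on `[0, Λ]`, `|e| ≤ Λ` ⟹ `F(e) = ∫₀^Λ f(t)·([t < e] − [e < −t]) dt`. -/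
theorem klol_odd_eq_integral (F f : ℝ → ℝ) {Λ : ℝ} (hodd : ∀ x, F (-x) = -F x)
    (hF : ∀ x, 0 ≤ x → x ≤ Λ → F x = ∫ t in (0 : ℝ)..x, f t) (hf : IntervalIntegrable f volume 0 Λ) {e : ℝ} (he : |e| ≤ Λ) :
    F e = ∫ t in (0 : ℝ)..Λ, f t * ((if t < e then (1 : ℝ) else 0) - (if e < -t then (1 : ℝ) else 0)) := by
  have hΛ : 0 ≤ Λ := (abs_nonneg e).trans he
  have hrw : (fun t => f t * ((if t < e then (1 : ℝ) else 0) - (if e < -t then (1 : ℝ) else 0))) =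
      fun t => f t * (if t < e then (1 : ℝ) else 0) - f t * (if t < -e then (1 : ℝ) else 0) := by
    funext t
    have : (e < -t) ↔ (t < -e) := by constructor <;> intro h <;> linarith
    rw [mul_sub, if_congr this rfl rfl]
  rw [hrw, integral_sub (klol_intervalIntegrable_mul_ite_lt hf e) (klol_intervalIntegrable_mul_ite_lt hf (-e))]
  rcases le_or_gt 0 e with he0 | he0
  · -- `e ≥ 0`: the first piece is `F e`, the second vanishes
    have heΛ : e ≤ Λ := (le_abs_self e).trans he
    rw [klol_integral_mul_ite_lt f he0 heΛ, klol_integral_mul_ite_lt_of_nonpos f hΛ (neg_nonpos.mpr he0), sub_zero]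
    exact hF e he0 heΛ
  · -- `e < 0`: the first piece vanishes, the second is `F(−e) = −F e`
    have hne0 : 0 ≤ -e := by linarith
    have hneΛ : -e ≤ Λ := (neg_le_abs e).trans he
    rw [klol_integral_mul_ite_lt_of_nonpos f hΛ he0.le, klol_integral_mul_ite_lt f hne0 hneΛ, zero_sub, ← hF (-e) hne0 hneΛ, hodd,
      neg_neg]

/-! ## §3 The sum over a finite family of levels: the two-sided shell asymmetry -/

/-- **ODD SUMS ARE ASYMMETRY INTEGRALS**: for a finite family of levels `e : ι → ℝ` with `|e k| ≤ Λ` on `S`, `F` odd with `F(x) = ∫₀^x f` on `[0, Λ]`: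
`Σ_{k ∈ S} F(e k) = ∫₀^Λ f(t)·(#{k ∈ S : t < e k} − #{k ∈ S : e k < −t}) dt`. -/
theorem klol_sum_odd_eq_integral_asym {ι : Type*} (S : Finset ι) (e : ι → ℝ) (F f : ℝ → ℝ) {Λ : ℝ}
    (hodd : ∀ x, F (-x) = -F x) (hF : ∀ x, 0 ≤ x → x ≤ Λ → F x = ∫ t in (0 : ℝ)..x, f t) (hf : IntervalIntegrable f volume 0 Λ)
    (he : ∀ k ∈ S, |e k| ≤ Λ) :
    ∑ k ∈ S, F (e k) =
      ∫ t in (0 : ℝ)..Λ, f t * (((S.filter fun k => t < e k).card : ℝ) - ((S.filter fun k => e k < -t).card : ℝ)) := by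
  classical
  have hterm : ∀ k ∈ S, F (e k) = ∫ t in (0 : ℝ)..Λ, f t * ((if t < e k then (1 : ℝ) else 0) - (if e k < -t then (1 : ℝ) else 0)) :=
    fun k hk => klol_odd_eq_integral F f hodd hF hf (he k hk)
  have hint : ∀ k ∈ S, IntervalIntegrable
      (fun t => f t * ((if t < e k then (1 : ℝ) else 0) - (if e k < -t then (1 : ℝ) else 0))) volume 0 Λ := by
    intro k _
    have hrw : (fun t => f t * ((if t < e k then (1 : ℝ) else 0) - (if e k < -t then (1 : ℝ) else 0))) =
        fun t => f t * (if t < e k then (1 : ℝ) else 0) - f t * (if t < -e k then (1 : ℝ) else 0) := by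
      funext t
      have : (e k < -t) ↔ (t < -e k) := by constructor <;> intro h <;> linarith
      rw [mul_sub, if_congr this rfl rfl]
    rw [hrw]
    exact (klol_intervalIntegrable_mul_ite_lt hf (e k)).sub (klol_intervalIntegrable_mul_ite_lt hf (-e k))
  rw [sum_congr rfl hterm, ← integral_finsetSum hint]
  refine integral_congr fun t _ => ?_
  simp only [← mul_sum, sum_sub_distrib, sum_boole]

/-- **THE BOUND**: with `|f| ≤ C_f` on `[0, Λ]` and the asymmetry `|#{t < e k} − #{e k < −t}| ≤ A` for `t ∈ [0, Λ]`,
`|Σ_{k ∈ S} F(e k)| ≤ Λ·(C_f·A)`. -/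
theorem klol_abs_sum_odd_le {ι : Type*} (S : Finset ι) (e : ι → ℝ) (F f : ℝ → ℝ) {Λ Cf A : ℝ} (hΛ : 0 ≤ Λ)
    (hodd : ∀ x, F (-x) = -F x) (hF : ∀ x, 0 ≤ x → x ≤ Λ → F x = ∫ t in (0 : ℝ)..x, f t) (hf : IntervalIntegrable f volume 0 Λ)
    (he : ∀ k ∈ S, |e k| ≤ Λ) (hfb : ∀ t ∈ Set.Icc 0 Λ, |f t| ≤ Cf)
    (hA : ∀ t ∈ Set.Icc 0 Λ, |((S.filter fun k => t < e k).card : ℝ) - ((S.filter fun k => e k < -t).card : ℝ)| ≤ A) :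
    |∑ k ∈ S, F (e k)| ≤ Λ * (Cf * A) := by
  rw [klol_sum_odd_eq_integral_asym S e F f hodd hF hf he]
  have hCf : 0 ≤ Cf := (abs_nonneg _).trans (hfb 0 ⟨le_rfl, hΛ⟩)
  have h := norm_integral_le_of_norm_le_const (a := (0 : ℝ)) (b := Λ) (C := Cf * A)
    (f := fun t => f t * (((S.filter fun k => t < e k).card : ℝ) - ((S.filter fun k => e k < -t).card : ℝ))) ?_
  · rw [Real.norm_eq_abs, sub_zero, abs_of_nonneg hΛ] at h
    linarith [h]
  · intro t ht
    rw [Set.uIoc_of_le hΛ] at ht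
    have ht' : t ∈ Set.Icc 0 Λ := ⟨ht.1.le, ht.2⟩
    rw [Real.norm_eq_abs, abs_mul]
    exact mul_le_mul (hfb t ht') (hA t ht') (abs_nonneg _) hCf

end Summit.HubbardSuperconductivity.HubbardSuperconductivity.Theorems.KLRegimeSplit

end
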